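import Literature.Topology.FourManifolds.KirbyMovesSlideSweepGraphs
import Literature.Topology.FourManifolds.MonotoneInverse
import HarnessLib

/-!
# The handle-slide sweep: graphs over the twisted height from two monotone curves

Topic `Literature/Topology/FourManifolds`; fact seat `provefact-IsStrictHandleSlide.isSurgery`
(R. C. Kirby, *The Topology of 4-Manifolds*, LNM 1374 (1989), Ch. I §4, Fig. 4.2; remaining content:
the named fact (S) `Literature.Topology.FourManifolds.FramedLink.IsStrictHandleSlide.slideModel`).
The planar sweep `SlideSweep.exists_planarSweep` (`KirbyMovesSlideSweepExchange2.lean`) exchanges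
the graphs `x = g₂ y` and `x = g₁ y` of two globally smooth functions agreeing for `|y| ≥ Y`. The
slide produces the two arcs as **parametrised curves** `s ↦ (xᵢ s, yᵢ s)` in the twisted chart
(the finger knot `K₁` and the slid circle `K₂` read in the meridian slice), along which the twisted
height `yᵢ` is strictly decreasing with negative derivative (`RouteMonotone.lean`,
`FingerMonotone.lean`), coinciding as point sets beyond the tips (`|y| ≥ Y`: the common stubs) and
staying in the disc of radius `ρ` between the tips. This file converts such data into the input of
the planar sweep:

* `SlideSweep.exists_graphs_of_curves` — smooth `g₁, g₂ : ℝ → ℝ` with `g₁ = g₂` on `{|y| ≥ Y}`,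
  `gᵢ (yᵢ s) = xᵢ s` whenever `|yᵢ s| ≤ Y''` (`Y < Y''`), and the disc bound of the sweep.

Construction: `gᵢ = φ · (xᵢ ∘ Yᵢ)` with `Yᵢ` the inverse of `yᵢ` (`AntiInverse`,
`AntiInverse_smooth`) and `φ` an even plateau (`SlideSweep.plateau`) equal to `1` on `[-Y'', Y'']`
and supported inside the common height range.

## References

* R. C. Kirby, *The Topology of 4-Manifolds*, LNM 1374, Springer (1989), Ch. I §4. [Kirby1989]
-/

open scoped ContDiff Topology
open Function Set Filter

noncomputable section

namespace Literature.Topology.FourManifolds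

namespace SlideSweep

/-- A smooth function on an open interval times a plateau supported inside it is globally smooth
(extended by zero). [folklore] -/
theorem contDiff_plateau_mul {f : ℝ → ℝ} {A B Y₁ Y₂ : ℝ} (hY : Y₁ < Y₂) (hA : A < -Y₂) (hB : Y₂ < B)
    (hf : ∀ y ∈ Ioo A B, ContDiffAt ℝ ∞ f y) :
    ContDiff ℝ ∞ (fun y ↦ plateau Y₁ Y₂ y * f y) := by
  rw [contDiff_iff_contDiffAt]
  intro y
  by_cases hy : y ∈ Ioo A B
  · exact (contDiff_plateau Y₁ Y₂).contDiffAt.mul (hf y hy)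
  · -- near `y` the plateau vanishes identically
    have hfar : |y| > Y₂ := by
      rw [mem_Ioo, not_and_or, not_lt, not_lt] at hy
      rcases hy with h | h
      · have : y < -Y₂ := lt_of_le_of_lt h hA
        rw [gt_iff_lt, lt_abs]; right; linarith
      · have : Y₂ < y := hB.trans_le h
        exact lt_of_lt_of_le this (le_abs_self y)
    have hev : (fun y ↦ plateau Y₁ Y₂ y * f y) =ᶠ[𝓝 y] fun _ ↦ (0 : ℝ) := by
      have ho : IsOpen {z : ℝ | Y₂ < |z|} := isOpen_lt continuous_const continuous_abs
      filter_upwards [ho.mem_nhds hfar] with z hz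
      rw [plateau_of_le_abs hY (le_of_lt hz), zero_mul]
    exact (contDiffAt_const (c := (0 : ℝ))).congr_of_eventuallyEq hev

/-- **Graphs over the twisted height from two monotone parametrised curves.** See the module
docstring. Data: parameters `aᵢ < bᵢ`; coordinates `xᵢ, yᵢ` smooth at the points of `[aᵢ, bᵢ]`,
`yᵢ` strictly decreasing on `[aᵢ, bᵢ]` with negative derivative inside, spanning `[-Y', Y']`
(`yᵢ bᵢ < -Y'`, `Y' < yᵢ aᵢ`) with `Y < Y'`; coincidence of the point sets on
`Y ≤ |y| ≤ Y'`; the disc bound `xᵢ² + yᵢ² ≤ ρ²` on `|yᵢ| ≤ Y`. [cite: Kirby1989, Ch. I §4] -/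
theorem exists_graphs_of_curves {x₁ y₁ x₂ y₂ : ℝ → ℝ} {a₁ b₁ a₂ b₂ Y Y' ρ : ℝ}
    (hab₁ : a₁ < b₁) (hab₂ : a₂ < b₂) (hYY' : Y < Y')
    (hx₁ : ∀ s ∈ Icc a₁ b₁, ContDiffAt ℝ ∞ x₁ s) (hy₁ : ∀ s ∈ Icc a₁ b₁, ContDiffAt ℝ ∞ y₁ s)
    (hx₂ : ∀ s ∈ Icc a₂ b₂, ContDiffAt ℝ ∞ x₂ s) (hy₂ : ∀ s ∈ Icc a₂ b₂, ContDiffAt ℝ ∞ y₂ s)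
    (hm₁ : StrictAntiOn y₁ (Icc a₁ b₁)) (hd₁ : ∀ s ∈ Ioo a₁ b₁, deriv y₁ s < 0)
    (hm₂ : StrictAntiOn y₂ (Icc a₂ b₂)) (hd₂ : ∀ s ∈ Ioo a₂ b₂, deriv y₂ s < 0)
    (hspan₁ : y₁ b₁ < -Y' ∧ Y' < y₁ a₁) (hspan₂ : y₂ b₂ < -Y' ∧ Y' < y₂ a₂)
    (hcoinc : ∀ s ∈ Icc a₁ b₁, Y ≤ |y₁ s| → |y₁ s| ≤ Y' → ∃ s' ∈ Icc a₂ b₂, x₂ s' = x₁ s ∧ y₂ s' = y₁ s)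
    (hdisc₁ : ∀ s ∈ Icc a₁ b₁, |y₁ s| ≤ Y → x₁ s ^ 2 + y₁ s ^ 2 ≤ ρ ^ 2)
    (hdisc₂ : ∀ s ∈ Icc a₂ b₂, |y₂ s| ≤ Y → x₂ s ^ 2 + y₂ s ^ 2 ≤ ρ ^ 2) :
    ∃ (g₁ g₂ : ℝ → ℝ) (Y'' : ℝ), Y < Y'' ∧ Y'' < Y' ∧ ContDiff ℝ ∞ g₁ ∧ ContDiff ℝ ∞ g₂ ∧
      (∀ y, Y ≤ |y| → g₁ y = g₂ y) ∧
      (∀ s ∈ Icc a₁ b₁, |y₁ s| ≤ Y'' → g₁ (y₁ s) = x₁ s) ∧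
      (∀ s ∈ Icc a₂ b₂, |y₂ s| ≤ Y'' → g₂ (y₂ s) = x₂ s) ∧
      (∀ y, |y| ≤ Y → ∀ θ ∈ Icc (0 : ℝ) 1, (g₂ y + θ * (g₁ y - g₂ y)) ^ 2 + y ^ 2 ≤ ρ ^ 2) := by
  -- the inverses
  have hc₁ : ContinuousOn y₁ (Icc a₁ b₁) := fun s hs ↦ (hy₁ s hs).continuousAt.continuousWithinAt
  have hc₂ : ContinuousOn y₂ (Icc a₂ b₂) := fun s hs ↦ (hy₂ s hs).continuousAt.continuousWithinAt
  obtain ⟨hl₁, hr₁, hanti₁⟩ := AntiInverse hab₁ hc₁ hm₁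
  obtain ⟨hl₂, hr₂, hanti₂⟩ := AntiInverse hab₂ hc₂ hm₂
  have hsm₁ := AntiInverse_smooth hab₁ hc₁ hm₁ (fun s hs ↦ hy₁ s (Ioo_subset_Icc_self hs)) hd₁
  have hsm₂ := AntiInverse_smooth hab₂ hc₂ hm₂ (fun s hs ↦ hy₂ s (Ioo_subset_Icc_self hs)) hd₂
  set G₁ := invFunOn y₁ (Icc a₁ b₁) with hG₁
  set G₂ := invFunOn y₂ (Icc a₂ b₂) with hG₂
  set f₁ : ℝ → ℝ := fun y ↦ x₁ (G₁ y) with hf₁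
  set f₂ : ℝ → ℝ := fun y ↦ x₂ (G₂ y) with hf₂
  -- levels
  set Y'' := (Y + Y') / 2 with hY''
  set Y₃ := (Y'' + Y') / 2 with hY₃
  have h1 : Y < Y'' := by rw [hY'']; linarith
  have h2 : Y'' < Y₃ := by rw [hY₃]; linarith
  have h3 : Y₃ < Y' := by rw [hY₃]; linarith
  -- smoothness of `fᵢ` on `(-Y', Y')`: every such level is `yᵢ s` with `s` interior
  have hlev₁ : ∀ y ∈ Ioo (-Y') Y', ∃ s ∈ Ioo a₁ b₁, y₁ s = y := by
    intro y hy
    have hyI : y ∈ Icc (y₁ b₁) (y₁ a₁) := ⟨by linarith [hspan₁.1, hy.1], by linarith [hspan₁.2, hy.2]⟩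
    refine ⟨G₁ y, ?_, (hr₁ y hyI).1⟩
    have hmem := (hr₁ y hyI).2
    rcases hmem.1.eq_or_lt with h | h
    · exfalso; have := (hr₁ y hyI).1; rw [← h] at this; linarith [hspan₁.2, hy.2]
    rcases hmem.2.eq_or_lt with h' | h'
    · exfalso; have := (hr₁ y hyI).1; rw [h'] at this; linarith [hspan₁.1, hy.1]
    exact ⟨h, h'⟩
  have hlev₂ : ∀ y ∈ Ioo (-Y') Y', ∃ s ∈ Ioo a₂ b₂, y₂ s = y := by
    intro y hy
    have hyI : y ∈ Icc (y₂ b₂) (y₂ a₂) := ⟨by linarith [hspan₂.1, hy.1], by linarith [hspan₂.2, hy.2]⟩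
    refine ⟨G₂ y, ?_, (hr₂ y hyI).1⟩
    have hmem := (hr₂ y hyI).2
    rcases hmem.1.eq_or_lt with h | h
    · exfalso; have := (hr₂ y hyI).1; rw [← h] at this; linarith [hspan₂.2, hy.2]
    rcases hmem.2.eq_or_lt with h' | h'
    · exfalso; have := (hr₂ y hyI).1; rw [h'] at this; linarith [hspan₂.1, hy.1]
    exact ⟨h, h'⟩
  have hfs₁ : ∀ y ∈ Ioo (-Y') Y', ContDiffAt ℝ ∞ f₁ y := by
    intro y hy
    obtain ⟨s, hs, rfl⟩ := hlev₁ y hy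
    have hG := (hsm₁ s hs).1
    have hGs : G₁ (y₁ s) = s := hl₁ s (Ioo_subset_Icc_self hs)
    have hx : ContDiffAt ℝ ∞ x₁ (G₁ (y₁ s)) := by rw [hGs]; exact hx₁ s (Ioo_subset_Icc_self hs)
    exact hx.comp (y₁ s) hG
  have hfs₂ : ∀ y ∈ Ioo (-Y') Y', ContDiffAt ℝ ∞ f₂ y := by
    intro y hy
    obtain ⟨s, hs, rfl⟩ := hlev₂ y hy
    have hG := (hsm₂ s hs).1
    have hGs : G₂ (y₂ s) = s := hl₂ s (Ioo_subset_Icc_self hs)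
    have hx : ContDiffAt ℝ ∞ x₂ (G₂ (y₂ s)) := by rw [hGs]; exact hx₂ s (Ioo_subset_Icc_self hs)
    exact hx.comp (y₂ s) hG
  -- the graphs
  set φ : ℝ → ℝ := fun y ↦ plateau Y'' Y₃ y with hφ
  refine ⟨fun y ↦ φ y * f₁ y, fun y ↦ φ y * f₂ y, Y'', h1, by linarith, ?_, ?_, ?_, ?_, ?_, ?_⟩
  · exact contDiff_plateau_mul h2 (by linarith) h3 hfs₁
  · exact contDiff_plateau_mul h2 (by linarith) h3 hfs₂
  · -- agreement for `|y| ≥ Y`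
    intro y hyY
    by_cases hy : y ∈ Ioo (-Y') Y'
    · -- `f₁ y = f₂ y` by the coincidence of the stubs
      obtain ⟨s, hs, rfl⟩ := hlev₁ y hy
      have hs' := Ioo_subset_Icc_self hs
      have habs : |y₁ s| ≤ Y' := abs_le.2 ⟨hy.1.le, hy.2.le⟩
      obtain ⟨s', hs'I, hx, hyy⟩ := hcoinc s hs' hyY habs
      simp only [hf₁, hf₂]
      rw [hl₁ s hs', ← hyy, hl₂ s' hs'I, hx]
    · have hfar : Y₃ ≤ |y| := by
        rw [mem_Ioo, not_and_or, not_lt, not_lt] at hy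
        rcases hy with h | h
        · rw [le_abs]; right; linarith
        · exact le_trans h3.le ((h).trans (le_abs_self y))
      simp only [hφ, plateau_of_le_abs h2 hfar, zero_mul]
  · -- `g₁ (y₁ s) = x₁ s` for `|y₁ s| ≤ Y''`
    intro s hs hsY
    simp only [hφ, hf₁, plateau_of_abs_le h2 hsY, one_mul, hl₁ s hs]
  · intro s hs hsY
    simp only [hφ, hf₂, plateau_of_abs_le h2 hsY, one_mul, hl₂ s hs]
  · -- the disc bound on `|y| ≤ Y`
    intro y hyY θ hθ
    have hy : y ∈ Ioo (-Y') Y' := ⟨by have := (abs_le.1 hyY).1; linarith, by have := (abs_le.1 hyY).2; linarith⟩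
    have hφ1 : φ y = 1 := by simp only [hφ]; exact plateau_of_abs_le h2 (hyY.trans h1.le)
    obtain ⟨s₁, hs₁, hys₁⟩ := hlev₁ y hy
    obtain ⟨s₂, hs₂, hys₂⟩ := hlev₂ y hy
    have e1 : φ y * f₁ y = x₁ s₁ := by rw [hφ1, one_mul, hf₁]; simp only; rw [← hys₁, hl₁ s₁ (Ioo_subset_Icc_self hs₁)]
    have e2 : φ y * f₂ y = x₂ s₂ := by rw [hφ1, one_mul, hf₂]; simp only; rw [← hys₂, hl₂ s₂ (Ioo_subset_Icc_self hs₂)]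
    show (φ y * f₂ y + θ * (φ y * f₁ y - φ y * f₂ y)) ^ 2 + y ^ 2 ≤ ρ ^ 2
    rw [e1, e2]
    have hb₁ := hdisc₁ s₁ (Ioo_subset_Icc_self hs₁) (by rw [hys₁]; exact hyY)
    have hb₂ := hdisc₂ s₂ (Ioo_subset_Icc_self hs₂) (by rw [hys₂]; exact hyY)
    rw [hys₁] at hb₁; rw [hys₂] at hb₂
    -- convex combination of `x₂ s₂` and `x₁ s₁` is bounded in square by the max
    have hconv : (x₂ s₂ + θ * (x₁ s₁ - x₂ s₂)) ^ 2 ≤ max (x₁ s₁ ^ 2) (x₂ s₂ ^ 2) := by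
      have e : x₂ s₂ + θ * (x₁ s₁ - x₂ s₂) = (1 - θ) * x₂ s₂ + θ * x₁ s₁ := by ring
      rw [e]
      have hsq : ((1 - θ) * x₂ s₂ + θ * x₁ s₁) ^ 2 ≤ (1 - θ) * x₂ s₂ ^ 2 + θ * x₁ s₁ ^ 2 := by
        nlinarith [sq_nonneg (x₁ s₁ - x₂ s₂), hθ.1, hθ.2, mul_nonneg hθ.1 (sub_nonneg.2 hθ.2)]
      calc ((1 - θ) * x₂ s₂ + θ * x₁ s₁) ^ 2 ≤ (1 - θ) * x₂ s₂ ^ 2 + θ * x₁ s₁ ^ 2 := hsq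
        _ ≤ (1 - θ) * max (x₁ s₁ ^ 2) (x₂ s₂ ^ 2) + θ * max (x₁ s₁ ^ 2) (x₂ s₂ ^ 2) := by
            gcongr
            · linarith [hθ.2]
            · exact le_max_right _ _
            · exact hθ.1
            · exact le_max_left _ _
        _ = max (x₁ s₁ ^ 2) (x₂ s₂ ^ 2) := by ring
    rcases le_total (x₁ s₁ ^ 2) (x₂ s₂ ^ 2) with h | h
    · rw [max_eq_right h] at hconv; linarith
    · rw [max_eq_left h] at hconv; linarith

end SlideSweep

end Literature.Topology.FourManifolds
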